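import Mathlib
import Summits.NavierStokesRegularity.NavierStokesRegularity.Theorems.DssFarFieldSlavingBlowupTypeIDssProfileSimilarityEnstrophyHessianCollar
import HarnessLib

/-!
# The CROSS-FLOW threshold WITHOUT the envelope at the constant `1`: `√(−t)‖ω × V‖ ≤ θ‖ω‖` with
  `θ < 1` ⇒ `V ≡ 0` for EVERY KNSS-gauge Type-I ancient mild field — no (D), no `HasTypeIDecay`, any `C`
  (pub-ns-dss, route `DssFarFieldSlaving`, crux `BlowupTypeIDssProfile`, stmt-NavierStokesRegularity-0155 —
  SUPPORT; typer seat g20, 2026-08-26; supersedes the constant `1/√2` of `…CrossFlowNoDecay` and removes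
  the envelope hypothesis of `…CrossFlowThreshold` at the classical level)

HONEST FRAMING. An exclusion statement about a HYPOTHETICAL object (a Type-I ancient mild solution in
the Koch–Nadirashvili–Seregin–Šverák gauge, `IsTypeIAncientMild C V`, ANY constant `C`) under a pointwise
hypothesis nobody asserts; `1` is the threshold of the argument and nothing is said at or above it;
nothing numerical; nothing here bears on Navier–Stokes regularity or blow-up.

THE STATEMENT (`typeI_ancient_eq_zero_of_crossFlow_lt_one_noDecay`). If
`√(−t)·‖ω(t,x) × V(t,x)‖ ≤ θ‖ω(t,x)‖` for all `t < 0`, `x` (the similarity velocity component across the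
vorticity is at most `θ` on the vortex set) and `θ < 1`, then `V ≡ 0`. This contains T31⁗
(`typeI_ancient_eq_zero_of_rate_lt_one`: `‖ω × V‖ ≤ ‖ω‖‖V‖`) and the envelope version
`typeI_ancient_eq_zero_of_crossFlow_lt_one`, with the same constant `1` and no spatial hypothesis.

THE MECHANISM is that of `…CrossFlowNoDecay` (cut-off similarity enstrophy, stretching in Lamb form
against the cut-off) with the pointwise bound `‖curl Ω‖² ≤ 2|∇Ω|²_F` replaced by the WEIGHTED div–curl
identity of the tree (`integral_mul_frobeniusNormSq_fderiv_eq`: `∫φ|∇Ω|²_F = ∫φ‖curl Ω‖² − ∫Dφ((Ω·∇)Ω)`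
for divergence-free `Ω`), whose error term is a HESSIAN collar: one more integration by parts
(`∫ D[Dφ(Ω)](Ω) = 0`, `div Ω = 0`, `integral_mul_divergence_add_eq_zero_left`) gives
`∫Dφ((Ω·∇)Ω) = −∫D²φ(Ω, Ω)`, and `‖D²φ_R‖ ≤ c_H/R²` by scaling of the unit cut-off
(`exists_norm_iteratedFDeriv_two_smoothTransition_cutoff_le`, file `…SimilarityEnstrophyHessianCollar`). Hence `∫φ‖curl Ω‖² ≤ ∫φ|∇Ω|²_F + (c_H/R²)∫_{B̄_{2R}}‖Ω‖²`
(`integral_cutoff_mul_norm_curl_sq_le`), Young with the constant `1`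
(`θ‖Ω‖‖curl Ω‖ ≤ ‖curl Ω‖² + (θ²/4)‖Ω‖²`), the budget `Z_R' ≤ −½(1 − θ²)Z_R + (L/R)∫_{B̄_{2R}}‖Ω‖²`
(`deriv_cutoffEnstrophy_le_of_crossFlow_one`), and the bootstrap/endgame of `…BeltramiLiouville`.
-/

noncomputable section

set_option linter.dupNamespace false

namespace Summit.NavierStokesRegularity.NavierStokesRegularity.Theorems.SimilarityEnstrophy

open MeasureTheory Set Filter Topology Metric InnerProductSpace Function Real
open scoped RealInnerProductSpace Laplacian ContDiff
open Literature.Analysis Literature.Analysis.FluidPDE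
open Summit.NavierStokesRegularity.NavierStokesRegularity.Theorems
open Summit.NavierStokesRegularity.NavierStokesRegularity.Theorems.GaussianGap
open Summit.NavierStokesRegularity.NavierStokesRegularity.Theorems.BlobRiccatiClosure.TypeIApexLiouville

variable {C : ℝ} {V : ℝ → EuclideanSpace ℝ (Fin 3) → EuclideanSpace ℝ (Fin 3)}

/-! ### The cut-off stretching under the cross-flow hypothesis, constant `1` -/

/-- **The stretching term against the cut-off under the cross-flow hypothesis, constant `1`** (one slice):
with `‖U‖ ≤ C` and `‖Ω × U‖ ≤ θ‖Ω‖` pointwise,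
`2∫φ⟪DU Ω, Ω⟫ ≤ 2∫φ‖∇Ω‖²_F + (θ²/2)∫φ‖Ω‖² + (3C c₁/R + 2c_H/R²) ∫_{B̄_{2R}}‖Ω‖²` — as
`two_mul_integral_cutoff_stretching_le_of_crossFlow`, with Young `θbc ≤ c² + (θ²/4)b²` and the weighted
curl bound `integral_cutoff_mul_norm_curl_sq_le` in place of the pointwise `‖curl Ω‖² ≤ 2|∇Ω|²_F`. [this file] -/
theorem two_mul_integral_cutoff_stretching_le_of_crossFlow_one (hV : IsTypeIAncientMild C V) {c₁ c_H : ℝ}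
    (hc₁ : ∀ R : ℝ, 0 < R → ∀ y : EuclideanSpace ℝ (Fin 3),
      ‖fderiv ℝ (fun z : EuclideanSpace ℝ (Fin 3) => smoothTransition (2 - ‖z‖ ^ 2 / R ^ 2)) y‖ ≤
        c₁ / R)
    (hcH : ∀ R : ℝ, 0 < R → ∀ y : EuclideanSpace ℝ (Fin 3),
      ‖iteratedFDeriv ℝ 2 (fun z : EuclideanSpace ℝ (Fin 3) => smoothTransition (2 - ‖z‖ ^ 2 / R ^ 2)) y‖
        ≤ c_H / R ^ 2)
    {θ : ℝ} {s : ℝ}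
    (hX : ∀ y : EuclideanSpace ℝ (Fin 3),
      ‖cross (lerayVorticity V s y) (lerayOrbit V s y)‖ ≤ θ * ‖lerayVorticity V s y‖)
    {R : ℝ} (hR : 0 < R) :
    2 * (∫ y, smoothTransition (2 - ‖y‖ ^ 2 / R ^ 2) *
        ⟪fderiv ℝ (lerayOrbit V s) y (lerayVorticity V s y), lerayVorticity V s y⟫) ≤
      2 * (∫ y, smoothTransition (2 - ‖y‖ ^ 2 / R ^ 2) *
          frobeniusNormSq (fderiv ℝ (lerayVorticity V s) y)) +
        (θ ^ 2 / 2) * (∫ y, smoothTransition (2 - ‖y‖ ^ 2 / R ^ 2) * ‖lerayVorticity V s y‖ ^ 2) +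
        (3 * C * (c₁ / R) + 2 * (c_H / R ^ 2)) *
          ∫ y in closedBall (0 : EuclideanSpace ℝ (Fin 3)) (2 * R), ‖lerayVorticity V s y‖ ^ 2 := by
  have hC : 0 ≤ C := hV.nonneg
  set φ : EuclideanSpace ℝ (Fin 3) → ℝ := fun z => smoothTransition (2 - ‖z‖ ^ 2 / R ^ 2)
    with hφdef
  set Ω := lerayVorticity V s with hΩdef
  set U := lerayOrbit V s with hUdef
  have hφ1 : ContDiff ℝ 1 φ := contDiff_smoothTransition_cutoff (n := 1) R
  have hφ : ContDiff ℝ ∞ φ := contDiff_smoothTransition_cutoff (n := ⊤) R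
  have hφc : HasCompactSupport φ := hasCompactSupport_smoothTransition_cutoff hR
  have hφ0 : ∀ y, 0 ≤ φ y := fun y => smoothTransition_cutoff_nonneg R y
  have hΩ1 : ContDiff ℝ 1 Ω := signedBudget_contDiff_lerayVorticity_slice hV s (n := 1)
  have hΩs : ContDiff ℝ ∞ Ω := signedBudget_contDiff_lerayVorticity_slice hV s (n := ⊤)
  have hU1 : ContDiff ℝ 1 U := mustSqueeze_contDiff_lerayOrbit_slice hV s (n := 1)
  have hUs : ContDiff ℝ ∞ U := mustSqueeze_contDiff_lerayOrbit_slice hV s (n := ⊤)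
  have hUC : ∀ y, ‖U y‖ ≤ C := fun y => norm_lerayOrbit_le_of_typeI hV s y
  have hdivΩ : VectorCalculus.IsDivFree Ω := fun y =>
    divergence_curl_eq_zero_holds _
      ((contDiff_lerayOrbit_slice_of_typeI hV s (n := (⊤ : ℕ∞)) le_rfl).of_le (by norm_cast)) y
  have hdivU : VectorCalculus.IsDivFree U :=
    (isDivFree_lerayOrbit_iff V s).2 (hV.isDivFree (neg_neg_of_pos (Real.exp_pos _)))
  -- continuity
  have hcΩ : Continuous Ω := hΩ1.continuous
  have hcU : Continuous U := hU1.continuous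
  have hcDΩ : Continuous (fderiv ℝ Ω) := hΩ1.continuous_fderiv one_ne_zero
  have hcφ : Continuous φ := hφ1.continuous
  have hcDφ : Continuous (fderiv ℝ φ) := hφ1.continuous_fderiv one_ne_zero
  have hcF : Continuous fun y => frobeniusNormSq (fderiv ℝ Ω y) :=
    continuous_frobeniusNormSq_fderiv_lerayVorticity hV s
  have hccurl : Continuous (curl Ω) := by
    rw [curl_eq_curlCLM_comp]; exact curlCLM.continuous.comp hcDΩ
  -- move the derivative onto `Ω`
  have hIBP := integral_mul_inner_stretching_eq hφ1 hφc hU1 hΩ1 hdivΩ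
  -- the Lamb split of the main term, pointwise
  have hsplit : ∀ y, φ y * ⟪U y, fderiv ℝ Ω y (Ω y)⟫ =
      φ y * ⟪convect U Ω y, Ω y⟫ - φ y * ⟪U y, cross (Ω y) (curl Ω y)⟫ := by
    intro y
    rw [← convect_apply, inner_convect_self_eq_sub Ω U y, mul_sub]
  -- integrability
  have iF : Integrable fun y => φ y * frobeniusNormSq (fderiv ℝ Ω y) :=
    (hcφ.mul hcF).integrable_of_hasCompactSupport hφc.mul_right
  have iZ : Integrable fun y => φ y * ‖Ω y‖ ^ 2 :=
    (hcφ.mul (hcΩ.norm.pow 2)).integrable_of_hasCompactSupport hφc.mul_right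
  have iC : Integrable fun y => φ y * ‖curl Ω y‖ ^ 2 :=
    (hcφ.mul (hccurl.norm.pow 2)).integrable_of_hasCompactSupport hφc.mul_right
  have iT : Integrable fun y => φ y * ⟪convect U Ω y, Ω y⟫ := by
    refine (hcφ.mul ?_).integrable_of_hasCompactSupport hφc.mul_right
    simp_rw [convect_apply]
    exact (hcDΩ.clm_apply hcU).inner hcΩ
  have hcL : Continuous fun y => cross (Ω y) (curl Ω y) :=
    (crossCLM.continuous₂.comp (hcΩ.prodMk hccurl)).congr fun _ => rfl
  have iL : Integrable fun y => φ y * ⟪U y, cross (Ω y) (curl Ω y)⟫ :=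
    (hcφ.mul (hcU.inner hcL)).integrable_of_hasCompactSupport hφc.mul_right
  -- (a1) the transport piece
  have hTr : 2 * (∫ y, φ y * ⟪convect U Ω y, Ω y⟫) = -(∫ y, fderiv ℝ φ y (U y) * ‖Ω y‖ ^ 2) :=
    two_mul_integral_mul_inner_convect_self_eq_of_isDivFree hφ hφc hΩs hUs hdivU
  have hTcollar : |∫ y, fderiv ℝ φ y (U y) * ‖Ω y‖ ^ 2| ≤
      C * (c₁ / R) * ∫ y in closedBall (0 : EuclideanSpace ℝ (Fin 3)) (2 * R), ‖Ω y‖ ^ 2 := by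
    refine abs_integral_le_of_weight_sq hcΩ (w := fun y => C * ‖fderiv ℝ φ y‖)
      (continuous_const.mul hcDφ.norm) (fun y hy => ?_) (fun y _ => ?_) (fun y => ?_)
    · show C * ‖fderiv ℝ φ y‖ = 0
      rw [hφdef, signedBudget_fderiv_cutoff_eq_zero hR hy, norm_zero, mul_zero]
    · show C * ‖fderiv ℝ φ y‖ ≤ C * (c₁ / R)
      exact mul_le_mul_of_nonneg_left (hc₁ R hR y) hC
    · rw [abs_mul, abs_of_nonneg (sq_nonneg ‖Ω y‖)]
      have e1 : |fderiv ℝ φ y (U y)| ≤ ‖fderiv ℝ φ y‖ * C := by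
        rw [← Real.norm_eq_abs]
        exact (ContinuousLinearMap.le_opNorm _ _).trans
          (mul_le_mul_of_nonneg_left (hUC y) (norm_nonneg _))
      calc |fderiv ℝ φ y (U y)| * ‖Ω y‖ ^ 2 ≤ (‖fderiv ℝ φ y‖ * C) * ‖Ω y‖ ^ 2 :=
            mul_le_mul_of_nonneg_right e1 (sq_nonneg _)
        _ = C * ‖fderiv ℝ φ y‖ * ‖Ω y‖ ^ 2 := by ring
  -- (a2) the Lamb piece with the constant `1`: `∫φ⟪U, Ω × curl Ω⟫ ≤ ∫φ‖curl Ω‖² + (θ²/4)∫φ‖Ω‖²`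
  have hLamb : (∫ y, φ y * ⟪U y, cross (Ω y) (curl Ω y)⟫) ≤
      (∫ y, φ y * ‖curl Ω y‖ ^ 2) + (θ ^ 2 / 4) * ∫ y, φ y * ‖Ω y‖ ^ 2 := by
    rw [← integral_const_mul, ← integral_add iC (iZ.const_mul _)]
    refine integral_mono iL (iC.add (iZ.const_mul _)) fun y => ?_
    dsimp only
    have h1 : ⟪U y, cross (Ω y) (curl Ω y)⟫ ≤ θ * (‖Ω y‖ * ‖curl Ω y‖) :=
      inner_lamb_le_of_crossFlow _ _ _ (hX y)
    have h3 : θ * (‖Ω y‖ * ‖curl Ω y‖) ≤ ‖curl Ω y‖ ^ 2 + θ ^ 2 / 4 * ‖Ω y‖ ^ 2 := by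
      nlinarith [sq_nonneg (‖curl Ω y‖ - θ * ‖Ω y‖ / 2)]
    have h4 : φ y * ⟪U y, cross (Ω y) (curl Ω y)⟫ ≤
        φ y * (‖curl Ω y‖ ^ 2 + θ ^ 2 / 4 * ‖Ω y‖ ^ 2) :=
      mul_le_mul_of_nonneg_left (h1.trans h3) (hφ0 y)
    linarith
  have hCurl := integral_cutoff_mul_norm_curl_sq_le hV hcH hR s
  -- (b) the collar term `−∫Dφ(Ω)⟪U, Ω⟫ ≤ C(c₁/R) I`
  have hcollar : |∫ y, fderiv ℝ φ y (Ω y) * ⟪U y, Ω y⟫| ≤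
      C * (c₁ / R) * ∫ y in closedBall (0 : EuclideanSpace ℝ (Fin 3)) (2 * R), ‖Ω y‖ ^ 2 := by
    refine abs_integral_le_of_weight_sq hcΩ (w := fun y => C * ‖fderiv ℝ φ y‖)
      (continuous_const.mul hcDφ.norm) (fun y hy => ?_) (fun y _ => ?_) (fun y => ?_)
    · show C * ‖fderiv ℝ φ y‖ = 0
      rw [hφdef, signedBudget_fderiv_cutoff_eq_zero hR hy, norm_zero, mul_zero]
    · show C * ‖fderiv ℝ φ y‖ ≤ C * (c₁ / R)
      exact mul_le_mul_of_nonneg_left (hc₁ R hR y) hC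
    · rw [abs_mul]
      have e1 : |fderiv ℝ φ y (Ω y)| ≤ ‖fderiv ℝ φ y‖ * ‖Ω y‖ := by
        rw [← Real.norm_eq_abs]; exact ContinuousLinearMap.le_opNorm _ _
      have e2 : |⟪U y, Ω y⟫| ≤ C * ‖Ω y‖ := by
        rw [← Real.norm_eq_abs]
        exact (norm_inner_le_norm _ _).trans (mul_le_mul_of_nonneg_right (hUC y) (norm_nonneg _))
      calc |fderiv ℝ φ y (Ω y)| * |⟪U y, Ω y⟫| ≤ (‖fderiv ℝ φ y‖ * ‖Ω y‖) * (C * ‖Ω y‖) :=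
            mul_le_mul e1 e2 (abs_nonneg _) (by positivity)
        _ = C * ‖fderiv ℝ φ y‖ * ‖Ω y‖ ^ 2 := by ring
  -- assemble
  have hmain : (∫ y, φ y * ⟪U y, fderiv ℝ Ω y (Ω y)⟫) =
      (∫ y, φ y * ⟪convect U Ω y, Ω y⟫) - ∫ y, φ y * ⟪U y, cross (Ω y) (curl Ω y)⟫ := by
    rw [← integral_sub iT iL]
    exact integral_congr_ae (Eventually.of_forall hsplit)
  have hT' := (neg_le_abs _).trans hTcollar
  have hT'' := (le_abs_self _).trans hTcollar
  have hcollar' := (neg_le_abs _).trans hcollar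
  have hI0 : 0 ≤ ∫ y in closedBall (0 : EuclideanSpace ℝ (Fin 3)) (2 * R), ‖Ω y‖ ^ 2 :=
    integral_nonneg fun y => sq_nonneg _
  rw [hIBP, hmain]
  nlinarith [hTr, hT', hT'', hLamb, hCurl, hcollar', hC, hI0]

/-! ### The budget and the Liouville theorem at the constant `1` -/

/-- **The localised similarity-enstrophy inequality under the cross-flow hypothesis, constant `1`, NO spatial
hypothesis**: `Z_R' ≤ −½(1 − θ²)Z_R + (L/R)∫_{B̄_{2R}}‖Ω‖²` for every `R ≥ 1`, `s`
(`L = 4Cc₁ + c₂ + 2c_H`). [this file] -/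
theorem deriv_cutoffEnstrophy_le_of_crossFlow_one (hV : IsTypeIAncientMild C V) {θ : ℝ}
    (hX : ∀ (s : ℝ) (y : EuclideanSpace ℝ (Fin 3)),
      ‖cross (lerayVorticity V s y) (lerayOrbit V s y)‖ ≤ θ * ‖lerayVorticity V s y‖) :
    ∃ L : ℝ, 0 ≤ L ∧ ∀ R : ℝ, 1 ≤ R → ∀ s : ℝ,
      deriv (fun σ => ∫ y, smoothTransition (2 - ‖y‖ ^ 2 / R ^ 2) * ‖lerayVorticity V σ y‖ ^ 2) s ≤
        -((1 / 2) * (1 - θ ^ 2)) *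
            (∫ y, smoothTransition (2 - ‖y‖ ^ 2 / R ^ 2) * ‖lerayVorticity V s y‖ ^ 2) +
          L / R * ∫ y in closedBall (0 : EuclideanSpace ℝ (Fin 3)) (2 * R),
            ‖lerayVorticity V s y‖ ^ 2 := by
  obtain ⟨c₁, hc₁0, hc₁⟩ :=
    exists_norm_fderiv_smoothTransition_cutoff_le (E := EuclideanSpace ℝ (Fin 3))
  obtain ⟨c₂, hc₂0, hc₂⟩ :=
    exists_abs_laplacian_smoothTransition_cutoff_le (E := EuclideanSpace ℝ (Fin 3))
  obtain ⟨c_H, hcH0, hcH⟩ := exists_norm_iteratedFDeriv_two_smoothTransition_cutoff_le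
  have hC : 0 ≤ C := hV.nonneg
  refine ⟨4 * C * c₁ + c₂ + 2 * c_H, by positivity, fun R hR1 s => ?_⟩
  have hR : 0 < R := lt_of_lt_of_le one_pos hR1
  rw [signedBudget_deriv_cutoffEnstrophy_eq hV hR s]
  set φ : EuclideanSpace ℝ (Fin 3) → ℝ := fun z => smoothTransition (2 - ‖z‖ ^ 2 / R ^ 2)
    with hφdef
  set Ω := lerayVorticity V s with hΩdef
  set U := lerayOrbit V s with hUdef
  set I : ℝ := ∫ y in closedBall (0 : EuclideanSpace ℝ (Fin 3)) (2 * R), ‖Ω y‖ ^ 2 with hIdef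
  have hI0 : 0 ≤ I := integral_nonneg fun y => sq_nonneg _
  have hφ1 : ContDiff ℝ 1 φ := contDiff_smoothTransition_cutoff (n := 1) R
  have hφ2 : ContDiff ℝ 2 φ := contDiff_smoothTransition_cutoff (n := 2) R
  have hcDφ : Continuous (fderiv ℝ φ) := hφ1.continuous_fderiv one_ne_zero
  have hΩ1 : ContDiff ℝ 1 Ω := signedBudget_contDiff_lerayVorticity_slice hV s (n := 1)
  have hcΩ : Continuous Ω := hΩ1.continuous
  have hUC : ∀ y, ‖U y‖ ≤ C := fun y => norm_lerayOrbit_le_of_typeI hV s y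
  -- (1) drift flux `≤ 0`
  have hD : (∫ y, fderiv ℝ φ y y * ‖Ω y‖ ^ 2) ≤ 0 := signedBudget_drift_flux_nonpos V R s
  -- (2) transport flux
  have hT : |∫ y, fderiv ℝ φ y (U y) * ‖Ω y‖ ^ 2| ≤ C * (c₁ / R) * I := by
    refine abs_integral_le_of_weight_sq hcΩ (w := fun y => C * ‖fderiv ℝ φ y‖)
      (continuous_const.mul hcDφ.norm) (fun y hy => ?_) (fun y _ => ?_) (fun y => ?_)
    · show C * ‖fderiv ℝ φ y‖ = 0
      rw [hφdef, signedBudget_fderiv_cutoff_eq_zero hR hy, norm_zero, mul_zero]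
    · show C * ‖fderiv ℝ φ y‖ ≤ C * (c₁ / R)
      exact mul_le_mul_of_nonneg_left (hc₁ R hR y) hC
    · rw [abs_mul, abs_of_nonneg (sq_nonneg ‖Ω y‖)]
      have e1 : |fderiv ℝ φ y (U y)| ≤ ‖fderiv ℝ φ y‖ * C := by
        rw [← Real.norm_eq_abs]
        exact (ContinuousLinearMap.le_opNorm _ _).trans
          (mul_le_mul_of_nonneg_left (hUC y) (norm_nonneg _))
      calc |fderiv ℝ φ y (U y)| * ‖Ω y‖ ^ 2 ≤ (‖fderiv ℝ φ y‖ * C) * ‖Ω y‖ ^ 2 :=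
            mul_le_mul_of_nonneg_right e1 (sq_nonneg _)
        _ = C * ‖fderiv ℝ φ y‖ * ‖Ω y‖ ^ 2 := by ring
  -- (3) viscous flux
  have hVisc : |∫ y, ‖Ω y‖ ^ 2 * (Δ φ) y| ≤ (c₂ / R ^ 2) * I := by
    refine abs_integral_le_of_weight_sq hcΩ (w := fun y => |(Δ φ) y|)
      (continuous_laplacian hφ2).abs (fun y hy => ?_) (fun y _ => hc₂ R hR y) (fun y => ?_)
    · show |(Δ φ) y| = 0
      rw [hφdef, signedBudget_laplacian_cutoff_eq_zero hR hy, abs_zero]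
    · rw [abs_mul, abs_of_nonneg (sq_nonneg ‖Ω y‖), mul_comm]
  have hR2 : c₂ / R ^ 2 ≤ c₂ / R := by
    rw [div_le_div_iff₀ (by positivity) hR]
    have : R ≤ R ^ 2 := by nlinarith
    exact mul_le_mul_of_nonneg_left this hc₂0
  have hRH : c_H / R ^ 2 ≤ c_H / R := by
    rw [div_le_div_iff₀ (by positivity) hR]
    have : R ≤ R ^ 2 := by nlinarith
    exact mul_le_mul_of_nonneg_left this hcH0
  -- (4) stretching
  have hS := two_mul_integral_cutoff_stretching_le_of_crossFlow_one hV hc₁ hcH (hX s) hR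
  -- assemble
  have hT' := (le_abs_self _).trans hT
  have hVisc' := ((le_abs_self _).trans hVisc).trans (mul_le_mul_of_nonneg_right hR2 hI0)
  have hH' : (3 * C * (c₁ / R) + 2 * (c_H / R ^ 2)) * I ≤ (3 * C * (c₁ / R) + 2 * (c_H / R)) * I := by
    gcongr
  have e : (4 * C * c₁ + c₂ + 2 * c_H) / R * I =
      C * (c₁ / R) * I + (3 * C * (c₁ / R) + 2 * (c_H / R)) * I + c₂ / R * I := by
    ring
  rw [e]
  nlinarith [hD, hT', hVisc', hS, hH']

/-- **The CROSS-FLOW threshold WITHOUT the envelope at the constant `1`, CLASSICAL, similarity variables.**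
A Type-I ancient mild solution in the KNSS gauge (`IsTypeIAncientMild C V`, ANY `C`, NO spatial hypothesis)
whose Leray orbit satisfies `‖Ω(s,y) × U(s,y)‖ ≤ θ‖Ω(s,y)‖` for all `s, y` with `θ < 1` vanishes on `t < 0`.
[this file] -/
theorem typeI_ancient_eq_zero_of_crossFlow_lt_one_noDecay_sim (hV : IsTypeIAncientMild C V) {θ : ℝ}
    (hθ : θ < 1)
    (hX : ∀ (s : ℝ) (y : EuclideanSpace ℝ (Fin 3)),
      ‖cross (lerayVorticity V s y) (lerayOrbit V s y)‖ ≤ θ * ‖lerayVorticity V s y‖) :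
    ∀ t < 0, ∀ x, V t x = 0 := by
  -- pass to `θ⁺ = max θ 0 ∈ [0, 1)`
  set θ' : ℝ := max θ 0 with hθ'
  have hθ'0 : 0 ≤ θ' := le_max_right _ _
  have hθ'1 : θ' < 1 := max_lt hθ one_pos
  have hX' : ∀ (s : ℝ) (y : EuclideanSpace ℝ (Fin 3)),
      ‖cross (lerayVorticity V s y) (lerayOrbit V s y)‖ ≤ θ' * ‖lerayVorticity V s y‖ := fun s y =>
    (hX s y).trans (mul_le_mul_of_nonneg_right (le_max_left _ _) (norm_nonneg _))
  obtain ⟨L, hL, hbudget⟩ := deriv_cutoffEnstrophy_le_of_crossFlow_one hV hX'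
  have hsq : θ' ^ 2 < 1 := by nlinarith
  have hκ : 0 < (1 / 2 : ℝ) * (1 - θ' ^ 2) := by nlinarith
  refine eq_zero_of_cutoffEnstrophy_eq_zero hV
    (cutoffEnstrophy_eq_zero_of_budget hV hκ hL fun R hR s => ?_)
  have h := hbudget R hR s
  linarith

/-- **The CROSS-FLOW threshold WITHOUT the envelope at the constant `1`, CLASSICAL, physical variables,
UNCONDITIONAL** (no (D), no `HasTypeIDecay`, ANY Type-I constant `C`). A Type-I ancient mild solution in the
KNSS gauge such that, at every `t < 0` and `x`, `√(−t)·‖ω(t,x) × V(t,x)‖ ≤ θ‖ω(t,x)‖` (`ω = curl V(t)`) with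
`θ < 1`, vanishes on `t < 0`. Supersedes `typeI_ancient_eq_zero_of_crossFlow_noDecay` (constant `1/√2`) and
`typeI_ancient_eq_zero_of_crossFlow_lt_one` (envelope); contains T31⁗ `typeI_ancient_eq_zero_of_rate_lt_one`
(`crossFlow_of_timeConstant`). [this file; conditional statement — nothing asserts the hypothesis for a
given field; nothing here bears on NS regularity] -/
theorem typeI_ancient_eq_zero_of_crossFlow_lt_one_noDecay (hV : IsTypeIAncientMild C V) {θ : ℝ}
    (hθ : θ < 1)
    (hX : ∀ t < 0, ∀ x,
      Real.sqrt (-t) * ‖cross (curl (V t) x) (V t x)‖ ≤ θ * ‖curl (V t) x‖) :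
    ∀ t < 0, ∀ x, V t x = 0 := by
  refine typeI_ancient_eq_zero_of_crossFlow_lt_one_noDecay_sim hV hθ fun s y => ?_
  have hl0 : 0 < Real.exp (-s / 2) := Real.exp_pos _
  have hk0 : 0 < Real.exp (-s) := Real.exp_pos _
  have ht0 : -Real.exp (-s) < 0 := neg_neg_of_pos hk0
  have hU : lerayOrbit V s y =
      Real.exp (-s / 2) • V (-Real.exp (-s)) (Real.exp (-s / 2) • y) := by
    rw [lerayOrbit_apply]
  have hΩ : lerayVorticity V s y =
      Real.exp (-s) • curl (V (-Real.exp (-s))) (Real.exp (-s / 2) • y) := by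
    rw [lerayVorticity_apply, curl_lerayOrbit]
  have h := hX _ ht0 (Real.exp (-s / 2) • y)
  rw [neg_neg, sqrt_exp_neg] at h
  set N : ℝ := ‖cross (curl (V (-Real.exp (-s))) (Real.exp (-s / 2) • y))
      (V (-Real.exp (-s)) (Real.exp (-s / 2) • y))‖ with hN
  set B : ℝ := ‖curl (V (-Real.exp (-s))) (Real.exp (-s / 2) • y)‖ with hB
  have eL : ‖cross (lerayVorticity V s y) (lerayOrbit V s y)‖ =
      Real.exp (-s) * (Real.exp (-s / 2) * N) := by
    rw [hU, hΩ, cross_smul_left, cross_smul_right, norm_smul, norm_smul,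
      Real.norm_of_nonneg hk0.le, Real.norm_of_nonneg hl0.le]
  have eR : ‖lerayVorticity V s y‖ = Real.exp (-s) * B := by
    rw [hΩ, norm_smul, Real.norm_of_nonneg hk0.le]
  rw [eL, eR]
  calc Real.exp (-s) * (Real.exp (-s / 2) * N)
      ≤ Real.exp (-s) * (θ * B) := mul_le_mul_of_nonneg_left h hk0.le
    _ = θ * (Real.exp (-s) * B) := by ring

/-- **T31⁗ re-derived through the no-envelope cross-flow threshold** (the exact statement of the tree's
`typeI_ancient_eq_zero_of_rate_lt_one` up to the form of the hypothesis — hence a kernel-checked `example`):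
time-only constant `θ < 1`, no envelope ⇒ `V ≡ 0`. [this file; bookkeeping] -/
example (hV : IsTypeIAncientMild C V) {θ : ℝ} (hθ : θ < 1)
    (hb : ∀ t < 0, ∀ x, Real.sqrt (-t) * ‖V t x‖ ≤ θ) :
    ∀ t < 0, ∀ x, V t x = 0 :=
  typeI_ancient_eq_zero_of_crossFlow_lt_one_noDecay hV hθ (crossFlow_of_timeConstant hb)

end Summit.NavierStokesRegularity.NavierStokesRegularity.Theorems.SimilarityEnstrophy

end
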